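import Summits.CriticalPhenomena.CardyFormulaZ2.Theorems.CardyRotToConfR2SymmetryUpgrade.Negative.SurgFatFamily
import Summits.CriticalPhenomena.CardyFormulaZ2.Theorems.CardyRotToConfR2SymmetryUpgrade.Negative.SurgSubarcImages
import Summits.CriticalPhenomena.CardyFormulaZ2.Theorems.CardyRotToConfR2SymmetryUpgradeNonTracing
import HarnessLib

/-!
# The fat-germ one-shot surgery of a chordal non-tracing family is chordal and non-tracing
# (line `germ-label-transport`, crux `stmt-CriticalPhenomena-0698`)

Stub `stub_fatSurgeryChordal` of the lead's skeleton
(`Cruxes/CardyRotToConfR2SymmetryUpgrade/GermLabelTransport`). For an admissible chordal family `S`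
whose laws charge only NON-TRACING classes (no representative maps a non-trivial parameter interval
into `∂D` non-constantly), the fat surgery `Negative.fatSurgery S` (`SurgFatFamily`) is again
CHORDAL (`ChordalFamily.IsChordal`: probability laws carried by classes from `a` to `b` inside
`closure D`) and NON-TRACING.

Proof, by the three unfolding lemmas of `fatSurgery`.
* Non-firing domain: the law is `S D`; both clauses are hypotheses.
* Firing domain with landing point `q = b`: the law is the Dirac mass at the chord class. The chord
  runs from `a` to `q = b`; its open part lies in `D` and its endpoints on `∂D`
  (`fireChord_mem_frontier_iff`), so its trace lies in `closure D`, and a parameter interval mapped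
  into `∂D` is mapped into the two endpoints, hence (connectedness of `[s, t]`, or directly: the
  midpoint is an interior parameter) is degenerate. One representative suffices
  (`Negative.forall_rep_notrace_iff`: sub-arc images are class invariants).
* Firing domain with `q ≠ b`: the law is the push-forward of `S (fireDom)` along the continuous
  prefixing map `firePrefix D` (`ae_map_iff`; both target events are Borel:
  `CurveClass.continuous_source/target`, `CurveClass.measurableSet_rangeSubset`,
  `CurveClass.measurableSet_setOf_notrace`). For an `S (fireDom)`-typical class `ξ = mk ξ₀`
  (source `q`, target `b`, trace in `closure fireDom ⊆ closure D`, non-tracing in `fireDom`) the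
  prefixed class is `mk (concatCM chord ξ₀)` with source `a`, target `b`, trace
  `chord ∪ trace ξ₀ ⊆ closure D`. For the representative `concatCM chord ξ₀` a parameter interval
  `[s, t]` mapped into `∂D` either meets `[0, 1/2)` — then its points `r ≤ 1/2` have
  `chord (2r) ∈ ∂D`, i.e. `r ∈ {0, 1/2}`, forcing `s = t = 0` — or lies in `[1/2, 1]`, where the
  curve is `r ↦ ξ₀ (2r - 1)` and the image equals `ξ₀ '' [2s-1, 2t-1] ⊆ ∂D ∩ closure fireDom ⊆
  ∂ fireDom` (`fireDom ⊆ D` open), degenerate by the non-tracing of `ξ₀` in `fireDom`.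

References: W. Werner, *Lectures on two-dimensional critical percolation* (2007), §3.2;
M. Aizenman, A. Burchard, Duke Math. J. 99 (1999), §2.1 (curve space).
-/

noncomputable section

open Set Filter Topology Metric MeasureTheory
open scoped unitInterval

namespace Summit.CriticalPhenomena.CardyFormulaZ2.Theorems.CardyRotToConfR2SymmetryUpgrade

open Literature.Probability.RandomPlanarGeometry MeasureTheory
open Literature.Probability.RandomPlanarGeometry.BrownianLoop
open Summit.CriticalPhenomena.CardyFormulaZ2.Theorems.CardyRotToConfR2SymmetryUpgrade.Negative

namespace FatSurgeryChordal

variable {D : DobrushinDomain}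

/-! ### The chord: trace in `closure D`, no traced boundary arc -/

/-- The trace of the surgery chord of a firing domain lies in `closure D` (open chord points are in
`D`, the endpoints on `∂D`). [folklore] -/
theorem range_fireChord_subset_closure (h : Fires D.carrier (D.pt 0)) :
    (fireChord D).range ⊆ closure D.carrier := by
  rintro _ ⟨s, rfl⟩
  by_cases hs : s = 0 ∨ s = 1
  · exact frontier_subset_closure ((fireChord_mem_frontier_iff h).2 hs)
  · rw [not_or] at hs
    have hs0 : 0 < (s : ℝ) := lt_of_le_of_ne s.2.1 fun h0 => hs.1 (Subtype.ext h0.symm)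
    have hs1 : (s : ℝ) < 1 := lt_of_le_of_ne s.2.2 fun h1 => hs.2 (Subtype.ext h1)
    exact subset_closure (fireChord_mem_carrier h hs0 hs1)

/-- **The chord traces no boundary arc**: a parameter interval `[s, t]`, `s ≤ t`, mapped by the
chord into `∂D` is mapped to one point (its parameters are endpoints `0`, `1`, so `s = t`).
[folklore] -/
theorem fireChord_notrace (h : Fires D.carrier (D.pt 0)) (s t : I) (hst : s ≤ t)
    (hsub : (fireChord D) '' Icc s t ⊆ frontier D.carrier) :
    ((fireChord D) '' Icc s t).Subsingleton := by
  have key : ∀ r ∈ Icc s t, r = 0 ∨ r = 1 := fun r hr =>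
    (fireChord_mem_frontier_iff h).1 (hsub ⟨r, hr, rfl⟩)
  suffices hst' : s = t by
    subst hst'
    rw [Icc_self, image_singleton]
    exact subsingleton_singleton
  by_contra hne
  have hlt : (s : ℝ) < t := lt_of_le_of_ne hst fun heq => hne (Subtype.ext heq)
  -- the midpoint is an interior parameter of `[0, 1]`
  set m : I := ⟨((s : ℝ) + t) / 2, by constructor <;> linarith [s.2.1, t.2.2]⟩ with hm
  have hsm : (s : ℝ) < m := by rw [hm]; show (s : ℝ) < ((s : ℝ) + t) / 2; linarith
  have hmt : (m : ℝ) < t := by rw [hm]; show ((s : ℝ) + t) / 2 < t; linarith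
  rcases key m ⟨hsm.le, hmt.le⟩ with h0 | h1
  · have : (m : ℝ) = 0 := by rw [h0]; rfl
    linarith [s.2.1]
  · have : (m : ℝ) = 1 := by rw [h1]; rfl
    linarith [t.2.2]

/-! ### The prefixed curve `concatCM chord ξ₀`: no traced boundary arc -/

/-- `dbl₂` is monotone. [folklore] -/
theorem dbl₂_mono {x y : I} (hxy : x ≤ y) : dbl₂ x ≤ dbl₂ y := by
  have hxy' : (x : ℝ) ≤ y := hxy
  show projIcc 0 1 zero_le_one (2 * (x : ℝ) - 1) ≤ projIcc 0 1 zero_le_one (2 * (y : ℝ) - 1)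
  exact monotone_projIcc zero_le_one (by linarith)

/-- A point of `∂D` in the closure of the crosscut domain lies on the frontier of the crosscut
domain (the crosscut domain is an open subset of the open set `D`). [folklore] -/
theorem mem_frontier_fireDom (h : Fires D.carrier (D.pt 0)) (hq : firePt D ≠ D.pt 1) {x : ℂ}
    (hxD : x ∈ frontier D.carrier) (hxcl : x ∈ closure (fireDom h hq).carrier) :
    x ∈ frontier (fireDom h hq).carrier := by
  rw [(fireDom h hq).isOpen.frontier_eq]
  refine ⟨hxcl, fun hxU => ?_⟩
  rw [D.isOpen.frontier_eq] at hxD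
  exact hxD.2 (carrier_fireDom_subset h hq hxU).1

section Concat

variable {ξ₀ : Curve ℂ} (hsrc : ξ₀.source = firePt D)

include hsrc

/-- Junction condition: the chord ends where `ξ₀` starts. [folklore] -/
theorem junction : (fireChord D).toContinuousMap 1 = ξ₀.toContinuousMap 0 := by
  show (fireChord D).target = ξ₀.source
  rw [target_fireChord, hsrc]

/-- On `[0, 1/2]` the prefixed curve is the chord at double speed. [folklore] -/
theorem prefixed_apply_of_le {r : I} (hr : (r : ℝ) ≤ 1 / 2) :
    (Curve.mk (concatCM (fireChord D).toContinuousMap ξ₀.toContinuousMap)) r =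
      fireChord D (dbl₁ r) := by
  show concatCM (fireChord D).toContinuousMap ξ₀.toContinuousMap r = _
  rw [concatCM_apply_of_eq (junction hsrc), if_pos hr]
  rfl

/-- On `[1/2, 1]` the prefixed curve is `ξ₀` at double speed. [folklore] -/
theorem prefixed_apply_of_ge {r : I} (hr : 1 / 2 ≤ (r : ℝ)) :
    (Curve.mk (concatCM (fireChord D).toContinuousMap ξ₀.toContinuousMap)) r =
      ξ₀ (dbl₂ r) := by
  show concatCM (fireChord D).toContinuousMap ξ₀.toContinuousMap r = _
  rw [concatCM_apply_of_eq (junction hsrc)]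
  rcases hr.lt_or_eq with hlt | heq
  · rw [if_neg (not_le.2 hlt)]
    rfl
  · rw [if_pos heq.symm.le]
    have h1 : dbl₁ r = 1 := Subtype.ext (by rw [coe_dbl₁ heq.symm.le, ← heq]; norm_num)
    have h2 : dbl₂ r = 0 := Subtype.ext (by rw [coe_dbl₂ hr, ← heq]; norm_num)
    rw [h1, h2, junction hsrc]
    rfl

end Concat

/-- **The prefixed curve traces no boundary arc of `D`.** If `ξ₀` has its trace in
`closure fireDom` and traces no boundary arc of the crosscut domain `fireDom`, then a curve `w`
running the chord on `[0, 1/2]` and `ξ₀` on `[1/2, 1]` (both at double speed) maps no non-trivial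
parameter interval into `∂D` non-constantly. [folklore] -/
theorem prefixed_notrace (h : Fires D.carrier (D.pt 0)) (hq : firePt D ≠ D.pt 1)
    {ξ₀ w : Curve ℂ} (hrange : ξ₀.range ⊆ closure (fireDom h hq).carrier)
    (hnt : ∀ s t : I, s ≤ t → ξ₀ '' Icc s t ⊆ frontier (fireDom h hq).carrier →
      (ξ₀ '' Icc s t).Subsingleton)
    (hle : ∀ r : I, (r : ℝ) ≤ 1 / 2 → w r = fireChord D (dbl₁ r))
    (hge : ∀ r : I, 1 / 2 ≤ (r : ℝ) → w r = ξ₀ (dbl₂ r))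
    (s t : I) (hst : s ≤ t) (hsub : w '' Icc s t ⊆ frontier D.carrier) :
    (w '' Icc s t).Subsingleton := by
  by_cases hs : (1 / 2 : ℝ) ≤ s
  · -- the whole interval is in the second half: the image is `ξ₀ '' [2s-1, 2t-1]`
    have hst' : (s : ℝ) ≤ t := hst
    have h1 : w '' Icc s t ⊆ ξ₀ '' Icc (dbl₂ s) (dbl₂ t) := by
      rintro _ ⟨r, hr, rfl⟩
      exact ⟨dbl₂ r, ⟨dbl₂_mono hr.1, dbl₂_mono hr.2⟩,
        (hge r (hs.trans (show (s : ℝ) ≤ r from hr.1))).symm⟩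
    have h2 : ξ₀ '' Icc (dbl₂ s) (dbl₂ t) ⊆ w '' Icc s t := by
      rintro _ ⟨p, hp, rfl⟩
      have hps : 2 * (s : ℝ) - 1 ≤ p := by
        rw [← coe_dbl₂ hs]; exact_mod_cast hp.1
      have hpt : (p : ℝ) ≤ 2 * t - 1 := by
        rw [← coe_dbl₂ (hs.trans hst')]; exact_mod_cast hp.2
      set r : I := ⟨((p : ℝ) + 1) / 2, by constructor <;> linarith [p.2.1, p.2.2]⟩ with hrdef
      have hr : (1 / 2 : ℝ) ≤ r := by
        rw [hrdef]; show (1 / 2 : ℝ) ≤ ((p : ℝ) + 1) / 2; linarith [p.2.1]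
      have hdr : dbl₂ r = p :=
        Subtype.ext (by rw [coe_dbl₂ hr, hrdef]; show 2 * (((p : ℝ) + 1) / 2) - 1 = p; ring)
      refine ⟨r, ⟨?_, ?_⟩, ?_⟩
      · show (s : ℝ) ≤ ((p : ℝ) + 1) / 2
        linarith
      · show ((p : ℝ) + 1) / 2 ≤ (t : ℝ)
        linarith
      · rw [hge r hr, hdr]
    have hfr : ξ₀ '' Icc (dbl₂ s) (dbl₂ t) ⊆ frontier (fireDom h hq).carrier := by
      intro x hx
      have hxD : x ∈ frontier D.carrier := hsub (h2 hx)
      obtain ⟨p, -, rfl⟩ := hx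
      exact mem_frontier_fireDom h hq hxD (hrange ⟨p, rfl⟩)
    exact (hnt _ _ (dbl₂_mono hst) hfr).anti h1
  · -- the interval meets `[0, 1/2)`: its parameters `r ≤ 1/2` are `0` or `1/2`, so `s = t = 0`
    have hs' : (s : ℝ) < 1 / 2 := not_le.1 hs
    have key : ∀ r ∈ Icc s t, (r : ℝ) ≤ 1 / 2 → (r : ℝ) = 0 ∨ (r : ℝ) = 1 / 2 := by
      intro r hr hr2
      have hmem : w r ∈ frontier D.carrier := hsub ⟨r, hr, rfl⟩
      rw [hle r hr2] at hmem
      rcases (fireChord_mem_frontier_iff h).1 hmem with h0 | h1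
      · left
        have e : ((dbl₁ r : I) : ℝ) = 0 := by rw [h0]; rfl
        rw [coe_dbl₁ hr2] at e
        linarith
      · right
        have e : ((dbl₁ r : I) : ℝ) = 1 := by rw [h1]; rfl
        rw [coe_dbl₁ hr2] at e
        linarith
    have hs0 : (s : ℝ) = 0 := by
      rcases key s ⟨le_rfl, hst⟩ hs'.le with h0 | h5
      · exact h0
      · exact absurd h5 hs'.ne
    have ht0 : (t : ℝ) = 0 := by
      by_contra htne
      have htpos : 0 < (t : ℝ) := lt_of_le_of_ne t.2.1 (Ne.symm htne)
      set r : I := ⟨min (t : ℝ) (1 / 4), le_min t.2.1 (by norm_num),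
        (min_le_left _ _).trans t.2.2⟩ with hrdef
      have hr_pos : 0 < (r : ℝ) := lt_min htpos (by norm_num)
      have hr_le : (r : ℝ) ≤ 1 / 4 := min_le_right _ _
      have hr_t : (r : ℝ) ≤ t := min_le_left _ _
      have hsr : (s : ℝ) ≤ r := by rw [hs0]; exact hr_pos.le
      rcases key r ⟨hsr, hr_t⟩ (by linarith) with h0 | h5
      · linarith
      · linarith
    have hst' : s = t := Subtype.ext (by rw [hs0, ht0])
    subst hst'
    rw [Icc_self, image_singleton]
    exact subsingleton_singleton


/-! ### The surgery family is chordal and non-tracing -/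

/-- **The fat surgery of a chordal family is chordal.** [folklore] -/
theorem isChordal_fatSurgery {S : ChordalFamily} (hS : S.IsChordal) : (fatSurgery S).IsChordal := by
  intro D
  refine ⟨isProbabilityMeasure_fatSurgery hS D, ?_⟩
  by_cases h : Fires D.carrier (D.pt 0)
  · by_cases hq : firePt D = D.pt 1
    · rw [fatSurgery_of_eq h hq, ae_dirac_eq, eventually_pure]
      refine ⟨?_, ?_, ?_⟩
      · rw [CurveClass.source_mk]
        exact source_fireChord
      · rw [CurveClass.target_mk, target_fireChord, hq]
      · rw [CurveClass.range_mk]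
        exact range_fireChord_subset_closure h
    · rw [fatSurgery_of_ne h hq]
      -- the chordal event is Borel (`source`, `target` continuous; `rangeSubset` of a closed set)
      have hmeas : MeasurableSet {γ : CurveClass ℂ |
          γ.source = D.pt 0 ∧ γ.target = D.pt 1 ∧ γ.range ⊆ closure D.carrier} :=
        (CurveClass.continuous_source.measurable (measurableSet_singleton _)).inter
          ((CurveClass.continuous_target.measurable (measurableSet_singleton _)).inter
            (CurveClass.measurableSet_rangeSubset isClosed_closure))
      refine (ae_map_iff (measurable_firePrefix D).aemeasurable hmeas).2 ?_
      filter_upwards [(hS (fireDom h hq)).2] with ξ hξ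
      rw [pt_zero_fireDom, pt_one_fireDom] at hξ
      obtain ⟨hsrc, htgt, hrange⟩ := hξ
      refine ⟨source_firePrefix D ξ, by rw [target_firePrefix D hsrc, htgt], ?_⟩
      rw [range_firePrefix D hsrc, ← range_fireChord]
      exact union_subset (range_fireChord_subset_closure h)
        (hrange.trans (closure_fireDom_subset h hq))
  · rw [fatSurgery_of_not_fires h]
    exact (hS D).2

/-- **The fat surgery of a chordal non-tracing family is non-tracing.** [folklore] -/
theorem nonTracing_fatSurgery {S : ChordalFamily} (hS : S.IsChordal)
    (hnt : ∀ D : DobrushinDomain, ∀ᵐ γ ∂(S D), ∀ c : Curve ℂ, CurveClass.mk c = γ →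
      ∀ s t : I, s < t → c '' Icc s t ⊆ frontier D.carrier → (c '' Icc s t).Subsingleton)
    (D : DobrushinDomain) :
    ∀ᵐ γ ∂(fatSurgery S D), ∀ c : Curve ℂ, CurveClass.mk c = γ → ∀ s t : I, s < t →
      c '' Icc s t ⊆ frontier D.carrier → (c '' Icc s t).Subsingleton := by
  by_cases h : Fires D.carrier (D.pt 0)
  · by_cases hq : firePt D = D.pt 1
    · rw [fatSurgery_of_eq h hq, ae_dirac_eq, eventually_pure]
      exact (forall_rep_notrace_iff (fireChord D) (frontier D.carrier)).2 (fireChord_notrace h)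
    · rw [fatSurgery_of_ne h hq]
      refine (ae_map_iff (measurable_firePrefix D).aemeasurable
        (CurveClass.measurableSet_setOf_notrace isClosed_frontier)).2 ?_
      filter_upwards [(hS (fireDom h hq)).2, hnt (fireDom h hq)] with ξ hξ hξnt
      rw [pt_zero_fireDom] at hξ
      obtain ⟨hsrc, -, hrange⟩ := hξ
      obtain ⟨ξ₀, rfl⟩ := CurveClass.surjective_mk ξ
      rw [CurveClass.source_mk] at hsrc
      rw [CurveClass.range_mk] at hrange
      rw [firePrefix_mk, mkCM]
      exact (forall_rep_notrace_iff _ (frontier D.carrier)).2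
        (prefixed_notrace h hq hrange ((forall_rep_notrace_iff ξ₀ _).1 hξnt)
          (fun r hr => prefixed_apply_of_le hsrc hr) (fun r hr => prefixed_apply_of_ge hsrc hr))
  · rw [fatSurgery_of_not_fires h]
    exact hnt D

end FatSurgeryChordal

open FatSurgeryChordal in
/-- **S7f.1 (`stub_fatSurgeryChordal`).** The fat surgery of an admissible non-tracing family is
chordal and non-tracing. [folklore] -/
theorem stub_fatSurgeryChordal : ∀ S : ChordalFamily, IsLocalMarkovChordalFamily S → (∀ D : DobrushinDomain, ∀ᵐ γ ∂(S D), ∀ c : Curve ℂ, CurveClass.mk c = γ → ∀ s t : unitInterval, s < t → c '' Set.Icc s t ⊆ frontier D.carrier → (c '' Set.Icc s t).Subsingleton) → (Summit.CriticalPhenomena.CardyFormulaZ2.Theorems.CardyRotToConfR2SymmetryUpgrade.Negative.fatSurgery S).IsChordal ∧ (∀ D : DobrushinDomain, ∀ᵐ γ ∂(Summit.CriticalPhenomena.CardyFormulaZ2.Theorems.CardyRotToConfR2SymmetryUpgrade.Negative.fatSurgery S D), ∀ c : Curve ℂ, CurveClass.mk c = γ → ∀ s t : unitInterval, s < t → c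 '' Set.Icc s t ⊆ frontier D.carrier → (c '' Set.Icc s t).Subsingleton) :=
  fun _ hS hnt => ⟨isChordal_fatSurgery hS.isChordal, nonTracing_fatSurgery hS.isChordal hnt⟩

end Summit.CriticalPhenomena.CardyFormulaZ2.Theorems.CardyRotToConfR2SymmetryUpgrade

end
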